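import Literature.NumberTheory.DiophantineGeometry.GenEllLCyclic
import Mathlib.NumberTheory.Padics.Complex
import Mathlib.Analysis.Complex.Basic
import Mathlib.LinearAlgebra.Determinant
import HarnessLib

/-!
# [GenEll] §3: compactly bounded subsets of `M_ell(Q̄)`, Lemma 3.7, Theorem 3.8 (full Galois actions)

S. Mochizuki, *Arithmetic elliptic curves in general position*, Math. J. Okayama Univ. 52 (2010)
[cite: MochizukiGenEll2010] (kurims manuscript, Feb. 2009), pp. 18–20, read on the page:

> **Lemma 3.7. (Finite Exceptional Sets)** Let `K_V ⊆ M_ell(Q̄)` be a compactly bounded subset,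
> `ε ∈ ℝ_{>0}`. Then there exists a constant `C ∈ ℝ_{>0}` and a Galois-finite subset `Exc ⊆ M_ell(Q̄)`
> that satisfy the following property: Let `E_L` be an elliptic curve over a number field `L` with
> semi-stable reduction at all the finite primes of `L`; `d := [L : ℚ]`; `[E_L] ∈ M_ell(Q̄)` the point
> determined by `E_L`; `l` a prime number. Consider the following two conditions on the above data:
> (a) `l ≥ 100d · (ht^Falt([E_L]) + C · d^ε)`, and `E_L` has at least one prime of [bad] multiplicative
> reduction; (b) `[E_L] ∈ K_V`, and `l` is prime to the local heights of `E_L` at all of its primes of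
> multiplicative reduction. Then if (a) is satisfied, then `l` is `>` the local heights of `E_L` at all
> the primes of multiplicative reduction. If (b) is satisfied, and `[E_L] ∉ Exc`, then `E_L` has at
> least one prime of multiplicative reduction. If either (a) or (b) is satisfied, and, moreover, `E_L`
> admits an `l`-cyclic subgroup scheme `H_L ⊆ E_L`, then `[E_L] ∈ Exc`.
> **Theorem 3.8. (Full Special Linear Galois Actions)** Let `Q̄` be an algebraic closure of `ℚ`,
> `K_V ⊆ M_ell(Q̄)` a compactly bounded subset, `ε ∈ ℝ_{>0}`. Then there exist a constant `C ∈ ℝ_{>0}`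
> and a Galois-finite subset `Exc ⊆ M_ell(Q̄)` that satisfy the following property: Let `E_L` be an
> elliptic curve over a number field `L ⊆ Q̄` such that `[E_L] ∉ Exc`; `d := [L : ℚ]`; `l` a prime number
> such that [at least] one of the following two conditions is satisfied: (a) `l ≥ 23040 · 100d ·
> (ht^Falt([E_L]) + C · d^ε)`, and `E_L` has at least one prime of potentially multiplicative reduction;
> (b) `[E_L] ∈ K_V`, and `l` is prime to the local heights of `E_L` at all of its primes of potentially
> multiplicative reduction, as well as to the number `2 · 3 · 5 = 30`. Then the image of the Galois
> representation `Gal(Q̄/L) → GL₂(ℤ_l)` associated to `E_L` contains `SL₂(ℤ_l)`.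

## Rendering

* `MellCBData` — compactly bounded subsets of `M_ell(Q̄)` ([GenEll] Ex. 1.3 (ii) for `X = M̄_ell`, the
  `j`-line, with the convention [IUTchIV] Rmk. 2.3.1 (vi): bounding domains inside `M_ell`, i.e. finite
  `j`): the same data as `CBData` of `GenEllProjLine.lean` without the `ℙ¹ ∖ {0,1,∞}`-specific
  avoidance of `0, 1`; membership of `[E]` through the conjugates of `j(E)`;
* exceptional sets `Exc` are sets of minimal polynomials of `j`-invariants (`MellExcSet`), Galois-finite
  = finitely many in each degree — this makes "`[E_L] ∈ Exc`" independent of the presentation;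
* `EllPoint.ImageModLContainsSL2 P l` — "the image of `Γ_L` in `Aut(E[l]) ≅ GL₂(𝔽_l)` contains
  `SL₂(𝔽_l)`" (every `𝔽_l`-linear automorphism of `E[l]` of determinant `1` is a Galois element), over the
  tree's `WeierstrassCurve.geomTorsion` with Mathlib's `AddSubgroup.torsionBy.zmodModule`;
* `GenEll_lemma37`, `GenEll_thm38` — named facts. The conclusion "`Im(Gal(Q̄/L) → GL₂(ℤ_l)) ⊇
  SL₂(ℤ_l)`" of Thm. 3.8 is rendered LEVEL BY LEVEL — for every `n ≥ 1` the image in `Aut(E[l^n])`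
  contains the automorphisms of determinant `1` (`EllPoint.ImageModLContainsSL2 P (l^n)`) — which is
  equivalent to the printed `l`-adic containment because the Galois image is closed (compact); the
  `n = 1` case is the form [IUTchIV] Cor. 2.2's proof (P6) uses.
-/

noncomputable section

open NumberField IsDedekindDomain Metric

namespace Literature.NumberTheory.DiophantineGeometry.GenEll

/-! ## Compactly bounded subsets of `M_ell(Q̄)` -/

/-- The DATA of a compactly bounded subset `K_V ⊆ M_ell(Q̄)` ([GenEll] Ex. 1.3 (ii) for the `j`-line
`X = M̄_ell`, with [IUTchIV] Rmk. 2.3.1 (vi): bounding domains inside `M_ell`, i.e. away from `j = ∞`):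
the nonarchimedean support `primes` and bounding domains `K_∞ ⊆ ℂ` (nonempty conjugation-stable
compact domain) and `K_p ⊆ Q̄_p` (nonempty, Galois-stable, meeting every finite `K/ℚ_p` in a compact
domain). [cite: MochizukiGenEll2010, Ex 1.3 (ii) p.5] -/
structure MellCBData : Type 1 where
  /-- the nonarchimedean part of the support `V` -/
  primes : Finset ℕ
  /-- its elements are prime numbers -/
  primes_prime : ∀ p ∈ primes, p.Prime
  /-- the archimedean bounding domain `K_∞ ⊆ M_ell(ℂ) = ℂ` (values of `j`) -/
  Karc : Set ℂ
  /-- the nonarchimedean bounding domains `K_p ⊆ M_ell(Q̄_p) = Q̄_p` -/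
  Knon : (p : ℕ) → [Fact p.Prime] → Set (PadicAlgCl p)
  /-- `K_∞` is nonempty -/
  Karc_nonempty : Karc.Nonempty
  /-- `K_∞` is compact -/
  Karc_isCompact : IsCompact Karc
  /-- `K_∞` is a compact domain -/
  Karc_closure_interior : closure (interior Karc) = Karc
  /-- `K_∞` is stable under complex conjugation -/
  Karc_conj : ∀ z ∈ Karc, (starRingEnd ℂ) z ∈ Karc
  /-- `K_p` is nonempty -/
  Knon_nonempty : ∀ p ∈ primes, ∀ [Fact p.Prime], (Knon p).Nonempty
  /-- `K_p` is Galois-stable -/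
  Knon_galois : ∀ p ∈ primes, ∀ [Fact p.Prime], ∀ σ : PadicAlgCl p ≃ₐ[ℚ_[p]] PadicAlgCl p,
    ∀ y ∈ Knon p, σ y ∈ Knon p
  /-- `K_p ∩ X(K)` is a compact domain in `X(K)` for every finite `K/ℚ_p` inside `Q̄_p` -/
  Knon_compactDomain : ∀ p ∈ primes, ∀ [Fact p.Prime], ∀ K : IntermediateField ℚ_[p] (PadicAlgCl p),
    FiniteDimensional ℚ_[p] K →
      IsCompact {y : K | (y : PadicAlgCl p) ∈ Knon p} ∧
        closure (interior {y : K | (y : PadicAlgCl p) ∈ Knon p}) = {y : K | (y : PadicAlgCl p) ∈ Knon p}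

namespace MellCBData

/-- `[E] ∈ K_V`: every conjugate of `j(E)` in `ℂ` lies in `K_∞` and every conjugate in `Q̄_p` lies in
`K_p` for `p` in the support. [cite: MochizukiGenEll2010, Ex 1.3 (ii) p.6] -/
def Mem (D : MellCBData) (P : EllPoint) : Prop :=
  (∀ σ : P.F →+* ℂ, σ P.W.j ∈ D.Karc) ∧
    ∀ p ∈ D.primes, ∀ [Fact p.Prime], ∀ σ : P.F →+* PadicAlgCl p, σ P.W.j ∈ D.Knon p

/-- The compactly bounded subset `K_V ⊆ M_ell(Q̄)` as a set of presented points.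
[cite: MochizukiGenEll2010, Ex 1.3 (ii) p.6] -/
def toSet (D : MellCBData) : Set EllPoint := {P | D.Mem P}

end MellCBData

/-- An exceptional set `Exc ⊆ M_ell(Q̄)`, given invariantly as a set of minimal polynomials (over `ℚ`)
of `j`-invariants; `[E] ∈ Exc` iff the minimal polynomial of `j(E)` lies in it.
[cite: MochizukiGenEll2010, Lem 3.7 p.18] -/
def MellExcMem (Exc : Set (Polynomial ℚ)) (P : EllPoint) : Prop := minpoly ℚ P.W.j ∈ Exc

/-- `Exc` is Galois-finite ([GenEll] Ex. 1.3 (i)): finitely many members in each degree.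
[cite: MochizukiGenEll2010, Ex 1.3 (i) p.5] -/
def MellExcGaloisFinite (Exc : Set (Polynomial ℚ)) : Prop :=
  ∀ d : ℕ, {f ∈ Exc | f.natDegree ≤ d}.Finite

namespace EllPoint

/-- `E` has at least one prime of (bad) multiplicative reduction. [cite: MochizukiGenEll2010, Lem 3.7 p.18] -/
def HasMultPlace (P : EllPoint) : Prop :=
  ∃ v : HeightOneSpectrum (𝓞 P.F), P.W.HasMultiplicativeReductionAt v

/-- `E` has at least one prime of potentially multiplicative reduction (`ord_v(j) < 0`).
[cite: MochizukiGenEll2010, Thm 3.8 p.19] -/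
def HasPotMultPlace (P : EllPoint) : Prop :=
  ∃ v : HeightOneSpectrum (𝓞 P.F), P.IsPotMult v

/-- **"The image of `Γ_L` in `GL₂(𝔽_l)` contains `SL₂(𝔽_l)`"** (mod-`l` form): every `𝔽_l`-linear
endomorphism of the geometric `l`-torsion `E[l]` of determinant `1` is the action of some element of
`Γ_L = Gal(L̄/L)` (`E[l]` an `𝔽_l`-module via Mathlib's `AddSubgroup.torsionBy.zmodModule`; `l ≠ 0`).
[cite: MochizukiGenEll2010, Thm 3.8 p.19] -/
def ImageModLContainsSL2 (P : EllPoint) (l : ℕ) [NeZero l] : Prop :=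
  letI : Module (ZMod l) (P.W.geomTorsion (l : ℤ)) := AddSubgroup.torsionBy.zmodModule
  ∀ f : P.W.geomTorsion (l : ℤ) →ₗ[ZMod l] P.W.geomTorsion (l : ℤ), LinearMap.det f = 1 →
    ∃ σ : Field.absoluteGaloisGroup P.F, ∀ x : P.W.geomTorsion (l : ℤ), σ • x = f x

end EllPoint

/-- NAMED FACT — **[GenEll] Lemma 3.7 (Finite Exceptional Sets)**, verbatim up to the rendering
conventions of this file (`Exc` as a Galois-finite set of minimal polynomials of `j`, local heights
`−ord_v(j)`, `ht^Falt` the stable Faltings height, semistability via the tree's reduction types).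
[cite: MochizukiGenEll2010, Lem 3.7 p.18] -/
def GenEll_lemma37 : Prop :=
  ∀ (D : MellCBData) (ε : ℝ), 0 < ε → ∃ C : ℝ, 0 < C ∧ ∃ Exc : Set (Polynomial ℚ), MellExcGaloisFinite Exc ∧
    ∀ (P : EllPoint) (l : ℕ), l.Prime → P.IsSemistable →
      let condA : Prop := 100 * (P.degree : ℝ) * (P.htFalt + C * (P.degree : ℝ) ^ ε) ≤ l ∧ P.HasMultPlace
      let condB : Prop := D.Mem P ∧
        ∀ v : HeightOneSpectrum (𝓞 P.F), P.W.HasMultiplicativeReductionAt v → ¬ ((l : ℤ) ∣ P.localHeight v)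
      (condA → ∀ v : HeightOneSpectrum (𝓞 P.F), P.W.HasMultiplicativeReductionAt v → P.localHeight v < l) ∧
      (condB → ¬ MellExcMem Exc P → P.HasMultPlace) ∧
      ((condA ∨ condB) → P.AdmitsLCyclic l → MellExcMem Exc P)

/-- NAMED FACT — **[GenEll] Theorem 3.8 (Full Special Linear Galois Actions)**: the conclusion
"`Im(Gal(Q̄/L) → GL₂(ℤ_l)) ⊇ SL₂(ℤ_l)`" rendered level by level (for every `n ≥ 1` the image in
`Aut(E[l^n])` contains the determinant-`1` automorphisms; equivalent to the printed containment as the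
image is closed). `Exc` a Galois-finite set of minimal polynomials of `j`; condition (b) includes "`l`
prime to `30`". [cite: MochizukiGenEll2010, Thm 3.8 p.19] -/
def GenEll_thm38 : Prop :=
  ∀ (D : MellCBData) (ε : ℝ), 0 < ε → ∃ C : ℝ, 0 < C ∧ ∃ Exc : Set (Polynomial ℚ), MellExcGaloisFinite Exc ∧
    ∀ (P : EllPoint) (l : ℕ) [Fact l.Prime], ¬ MellExcMem Exc P →
      ((23040 * 100 * (P.degree : ℝ) * (P.htFalt + C * (P.degree : ℝ) ^ ε) ≤ l ∧ P.HasPotMultPlace) ∨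
        (D.Mem P ∧ (∀ v : HeightOneSpectrum (𝓞 P.F), P.IsPotMult v → ¬ ((l : ℤ) ∣ P.localHeight v)) ∧
          Nat.Coprime l 30)) →
      ∀ n : ℕ, 0 < n → P.ImageModLContainsSL2 (l ^ n)

end Literature.NumberTheory.DiophantineGeometry.GenEll

end
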